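import Summits.QuantumFields.YangMills.Theorems.ColdStartUniversalityLatticeLangevinCocycleRiemann
import HarnessLib

/-!
# Route `ColdStartUniversality` (rung input (M), crux K_A1 stmt-QuantumFields-24809): the RESTART IDENTITY — after a
# dyadic splicing time, the Itô integrals along the spliced process are the frozen solution identity of the second leg

Helper file (seat `ym-line-csu-p1`, g4), heart of the splicing proof of the flow (cocycle) property.  For the regular
flow `U` on the canonical space, a start `x`, a DYADIC time `s = k₀/2^{m₀}`, the splice `X` (first leg `U x`, second leg
`U (U x s ·) (· − s) ∘ θ_s`) and ANY Itô integrals `K n` of the noise coefficients `σ_{e,n}(ρ∘X)ᵢⱼ` against `W^{e,n}`: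
for every `r ≥ 0`, almost surely

  `ρ(U (U x s p) r (θ_s p))ᵢⱼ − ρ(U x s p)ᵢⱼ − ∫₀ʳ b(ρ ∘ U (U x s p) · (θ_s p))ᵢⱼ = Σₙ (K n (s+r) p − K n s p)`

(`restartIdentity_at`).  Proof: both sides are limits in probability of the SAME dyadic Riemann–Itô sums — on the left by
the frozen solution identity (`tendsto_measure_riemannIdentity`, frozen with `tendsto_measure_comp_shift_of_forall`),
on the right by u.c.p. convergence to the Itô integrals; the sums agree by the restart identity `sample_integral_shift`
(the dyadic grid of level `m ≥ m₀` contains `s` and is shift-invariant).  No definition, no sorry.  RECORD-rung R3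
plumbing; nothing here bears on the mass gap.
-/

set_option autoImplicit false

noncomputable section

namespace Summit.QuantumFields.YangMills.Theorems.ColdStartUniversality

open MeasureTheory ProbabilityTheory Filter Topology Finset
open scoped NNReal ENNReal BigOperators
open Literature Literature.Probability.Process Literature.MathematicalPhysics.QuantumFieldTheory
open Literature.MathematicalPhysics.QuantumLattice (fundamentalRep fundamentalLatticeRep continuous_fundamentalRep)

variable {Ω : Type} [MeasurableSpace Ω] {P : Measure Ω} [IsProbabilityMeasure P] {L : ℕ} [NeZero L]
  {W : ℝ≥0 → Ω → (Edge 3 L × NoiseIdx 2 → ℝ)}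

/-- The spliced process after the splicing time is the restarted flow (also AT the splicing time, by `U y 0 = y`).
[folklore] -/
theorem splice_add (hW : IsFlatBrownian W P)
    (U : GaugeConfig 3 L (Matrix.specialUnitaryGroup (Fin 2) ℂ) → ℝ≥0 →
      {p : ℝ≥0 → (Edge 3 L × NoiseIdx 2 → ℝ) // Continuous p ∧ p 0 = 0} →
      GaugeConfig 3 L (Matrix.specialUnitaryGroup (Fin 2) ℂ))
    (hU0 : ∀ y p, U y 0 p = y) (x : GaugeConfig 3 L (Matrix.specialUnitaryGroup (Fin 2) ℂ)) (s v : ℝ≥0)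
    (p : {p : ℝ≥0 → (Edge 3 L × NoiseIdx 2 → ℝ) // Continuous p ∧ p 0 = 0}) :
    (if s + v ≤ s then U x (s + v) p else U (U x s p) (s + v - s) ⟨fun u => p.1 (s + u) - p.1 s,
        continuous_shiftPath_and_zero (isFlatBrownian_canonical hW) s p⟩) =
      U (U x s p) v ⟨fun u => p.1 (s + u) - p.1 s, continuous_shiftPath_and_zero (isFlatBrownian_canonical hW) s p⟩ := by
  by_cases hv : v = 0
  · subst hv
    simp [hU0]
  · rw [if_neg (by simpa using hv), add_tsub_cancel_left]

/-- **The restart identity at a fixed time after a dyadic splicing time.** [folklore] -/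
theorem restartIdentity_at (hW : IsFlatBrownian W P) (β : ℝ)
    (U : GaugeConfig 3 L (Matrix.specialUnitaryGroup (Fin 2) ℂ) → ℝ≥0 →
      {p : ℝ≥0 → (Edge 3 L × NoiseIdx 2 → ℝ) // Continuous p ∧ p 0 = 0} →
      GaugeConfig 3 L (Matrix.specialUnitaryGroup (Fin 2) ℂ))
    (hU0 : ∀ y p, U y 0 p = y)
    (hprog : ∀ i : ℝ≥0, Measurable[@Prod.instMeasurableSpace (Set.Iic i)
        (GaugeConfig 3 L (Matrix.specialUnitaryGroup (Fin 2) ℂ) ×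
          {p : ℝ≥0 → (Edge 3 L × NoiseIdx 2 → ℝ) // Continuous p ∧ p 0 = 0}) inferInstance
        (@Prod.instMeasurableSpace (GaugeConfig 3 L (Matrix.specialUnitaryGroup (Fin 2) ℂ))
          {p : ℝ≥0 → (Edge 3 L × NoiseIdx 2 → ℝ) // Continuous p ∧ p 0 = 0} inferInstance
          ((isFlatBrownian_canonical hW).natFiltration i))]
      (fun q : Set.Iic i × (GaugeConfig 3 L (Matrix.specialUnitaryGroup (Fin 2) ℂ) ×
        {p : ℝ≥0 → (Edge 3 L × NoiseIdx 2 → ℝ) // Continuous p ∧ p 0 = 0}) => U q.2.1 q.1 q.2.2))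
    {G : Set (GaugeConfig 3 L (Matrix.specialUnitaryGroup (Fin 2) ℂ) ×
      {p : ℝ≥0 → (Edge 3 L × NoiseIdx 2 → ℝ) // Continuous p ∧ p 0 = 0})} (hGm : MeasurableSet G)
    (hGc : ∀ q ∈ G, Continuous fun r => U q.1 r q.2)
    (hGae : ∀ y, ∀ᵐ q ∂(P.map (fun ω => (⟨fun t => W t ω, continuous_path_and_zero hW ω⟩ :
        {p : ℝ≥0 → (Edge 3 L × NoiseIdx 2 → ℝ) // Continuous p ∧ p 0 = 0}))), (y, q) ∈ G)
    (hsol : ∀ y, (latticeLangevinDynamics (fundamentalLatticeRep 2) β).IsSolution (fundamentalRep (Fin 2))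
      (isFlatBrownian_canonical hW).natFiltration
      (P.map (fun ω => (⟨fun t => W t ω, continuous_path_and_zero hW ω⟩ :
        {p : ℝ≥0 → (Edge 3 L × NoiseIdx 2 → ℝ) // Continuous p ∧ p 0 = 0})))
      (fun (t : ℝ≥0) (p : {p : ℝ≥0 → (Edge 3 L × NoiseIdx 2 → ℝ) // Continuous p ∧ p 0 = 0}) => p.1 t) (U y))
    (x : GaugeConfig 3 L (Matrix.specialUnitaryGroup (Fin 2) ℂ)) (k₀ m₀ : ℕ) (e : Edge 3 L) (i j : Fin 2)
    {K : NoiseIdx 2 → ℝ≥0 → {p : ℝ≥0 → (Edge 3 L × NoiseIdx 2 → ℝ) // Continuous p ∧ p 0 = 0} → ℂ}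
    (hK : ∀ n, IsItoIntegralC (fun u p => (latticeLangevinDynamics (fundamentalLatticeRep 2) β).noise
        (matrixConfig (fundamentalRep (Fin 2)) (if u ≤ (k₀ : ℝ≥0) / 2 ^ m₀ then U x u p else
          U (U x ((k₀ : ℝ≥0) / 2 ^ m₀) p) (u - (k₀ : ℝ≥0) / 2 ^ m₀)
            ⟨fun v => p.1 ((k₀ : ℝ≥0) / 2 ^ m₀ + v) - p.1 ((k₀ : ℝ≥0) / 2 ^ m₀),
              continuous_shiftPath_and_zero (isFlatBrownian_canonical hW) ((k₀ : ℝ≥0) / 2 ^ m₀) p⟩)) e n i j)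
      (fun u (p : {p : ℝ≥0 → (Edge 3 L × NoiseIdx 2 → ℝ) // Continuous p ∧ p 0 = 0}) => p.1 u (e, n)) (K n)
      (isFlatBrownian_canonical hW).natFiltration
      (P.map (fun ω => (⟨fun t => W t ω, continuous_path_and_zero hW ω⟩ :
        {p : ℝ≥0 → (Edge 3 L × NoiseIdx 2 → ℝ) // Continuous p ∧ p 0 = 0}))))
    (r : ℝ≥0) :
    ∀ᵐ p ∂(P.map (fun ω => (⟨fun t => W t ω, continuous_path_and_zero hW ω⟩ :
        {p : ℝ≥0 → (Edge 3 L × NoiseIdx 2 → ℝ) // Continuous p ∧ p 0 = 0}))),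
      ((fundamentalRep (Fin 2) (U (U x ((k₀ : ℝ≥0) / 2 ^ m₀) p) r ⟨fun v => p.1 ((k₀ : ℝ≥0) / 2 ^ m₀ + v) -
            p.1 ((k₀ : ℝ≥0) / 2 ^ m₀), continuous_shiftPath_and_zero (isFlatBrownian_canonical hW)
              ((k₀ : ℝ≥0) / 2 ^ m₀) p⟩ e) : Matrix (Fin 2) (Fin 2) ℂ) i j -
          (fundamentalRep (Fin 2) (U x ((k₀ : ℝ≥0) / 2 ^ m₀) p e) : Matrix (Fin 2) (Fin 2) ℂ) i j -
          ∫ v in (0 : ℝ)..r, (latticeLangevinDynamics (fundamentalLatticeRep 2) β).drift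
            (matrixConfig (fundamentalRep (Fin 2)) (U (U x ((k₀ : ℝ≥0) / 2 ^ m₀) p) v.toNNReal
              ⟨fun v => p.1 ((k₀ : ℝ≥0) / 2 ^ m₀ + v) - p.1 ((k₀ : ℝ≥0) / 2 ^ m₀),
                continuous_shiftPath_and_zero (isFlatBrownian_canonical hW) ((k₀ : ℝ≥0) / 2 ^ m₀) p⟩)) e i j) =
        ∑ n : NoiseIdx 2, (K n ((k₀ : ℝ≥0) / 2 ^ m₀ + r) p - K n ((k₀ : ℝ≥0) / 2 ^ m₀) p) := by
  haveI := secondCountableTopology_su2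
  haveI := borelSpace_config L
  haveI : IsProbabilityMeasure (P.map (fun ω => (⟨fun t => W t ω, continuous_path_and_zero hW ω⟩ :
      {p : ℝ≥0 → (Edge 3 L × NoiseIdx 2 → ℝ) // Continuous p ∧ p 0 = 0}))) :=
    Measure.isProbabilityMeasure_map (measurable_pathMap hW).aemeasurable
  have hWc := isFlatBrownian_canonical hW
  set s : ℝ≥0 := (k₀ : ℝ≥0) / 2 ^ m₀ with hs
  -- measurability / continuity data of the splice
  have hadU : ∀ y u, Measurable[hWc.natFiltration u] (U y u) := fun y u => measurable_flow_at hW U hprog y u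
  have hadX : ∀ u, Measurable[hWc.natFiltration u] (fun p : {p : ℝ≥0 → (Edge 3 L × NoiseIdx 2 → ℝ) //
      Continuous p ∧ p 0 = 0} => if u ≤ s then U x u p else U (U x s p) (u - s)
        ⟨fun v => p.1 (s + v) - p.1 s, continuous_shiftPath_and_zero hWc s p⟩) :=
    fun u => measurable_splice hW U hprog x s u
  have hmX : Measurable fun q : {p : ℝ≥0 → (Edge 3 L × NoiseIdx 2 → ℝ) // Continuous p ∧ p 0 = 0} × ℝ =>
      (if q.2.toNNReal ≤ s then U x q.2.toNNReal q.1 else U (U x s q.1) (q.2.toNNReal - s)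
        ⟨fun v => q.1.1 (s + v) - q.1.1 s, continuous_shiftPath_and_zero hWc s q.1⟩) :=
    measurable_uncurry_of_prog (Z := fun u (p : {p : ℝ≥0 → (Edge 3 L × NoiseIdx 2 → ℝ) // Continuous p ∧ p 0 = 0}) =>
        if u ≤ s then U x u p else U (U x s p) (u - s) ⟨fun v => p.1 (s + v) - p.1 s,
          continuous_shiftPath_and_zero hWc s p⟩)
      (fun n => hWc.natFiltration n) (fun n => hWc.natFiltration.le _)
      (fun n => measurable_splice_prog hW U hprog x s n)
  have hcX := ae_continuous_splice hW U hU0 hprog hGm hGc hGae x s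
  have hYs : Measurable[hWc.natFiltration s] (U x s) := hadU x s
  -- real and imaginary parts
  have key : ∀ (c : ℂ →L[ℝ] ℝ),
      (∀ (n : NoiseIdx 2) {H Z : ℝ≥0 → {p : ℝ≥0 → (Edge 3 L × NoiseIdx 2 → ℝ) // Continuous p ∧ p 0 = 0} → ℂ},
        IsItoIntegralC H (fun u (p : {p : ℝ≥0 → (Edge 3 L × NoiseIdx 2 → ℝ) // Continuous p ∧ p 0 = 0}) => p.1 u (e, n))
          Z hWc.natFiltration (P.map (fun ω => (⟨fun t => W t ω, continuous_path_and_zero hW ω⟩ :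
            {p : ℝ≥0 → (Edge 3 L × NoiseIdx 2 → ℝ) // Continuous p ∧ p 0 = 0}))) →
        IsItoIntegral (fun u p => c (H u p)) (fun u (p : {p : ℝ≥0 → (Edge 3 L × NoiseIdx 2 → ℝ) //
          Continuous p ∧ p 0 = 0}) => p.1 u (e, n)) (fun u p => c (Z u p)) hWc.natFiltration
          (P.map (fun ω => (⟨fun t => W t ω, continuous_path_and_zero hW ω⟩ :
            {p : ℝ≥0 → (Edge 3 L × NoiseIdx 2 → ℝ) // Continuous p ∧ p 0 = 0})))) →
      ∀ᵐ p ∂(P.map (fun ω => (⟨fun t => W t ω, continuous_path_and_zero hW ω⟩ :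
        {p : ℝ≥0 → (Edge 3 L × NoiseIdx 2 → ℝ) // Continuous p ∧ p 0 = 0}))),
        c ((fundamentalRep (Fin 2) (U (U x s p) r ⟨fun v => p.1 (s + v) - p.1 s,
              continuous_shiftPath_and_zero hWc s p⟩ e) : Matrix (Fin 2) (Fin 2) ℂ) i j -
            (fundamentalRep (Fin 2) (U x s p e) : Matrix (Fin 2) (Fin 2) ℂ) i j -
            ∫ v in (0 : ℝ)..r, (latticeLangevinDynamics (fundamentalLatticeRep 2) β).drift
              (matrixConfig (fundamentalRep (Fin 2)) (U (U x s p) v.toNNReal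
                ⟨fun v => p.1 (s + v) - p.1 s, continuous_shiftPath_and_zero hWc s p⟩)) e i j) =
          c (∑ n : NoiseIdx 2, (K n (s + r) p - K n s p)) := by
    intro c hc
    have hcm : ∀ n, Measurable fun V : GaugeConfig 3 L (Matrix.specialUnitaryGroup (Fin 2) ℂ) =>
        c ((latticeLangevinDynamics (fundamentalLatticeRep 2) β).noise (matrixConfig (fundamentalRep (Fin 2)) V) e n i j) :=
      fun n => (c.continuous.comp (continuous_noise_entry β e n i j)).measurable
    -- adaptedness of the Riemann integrands
    have hA : ∀ (y : GaugeConfig 3 L (Matrix.specialUnitaryGroup (Fin 2) ℂ)) (n : NoiseIdx 2),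
        Adapted hWc.natFiltration (fun u q =>
          c ((latticeLangevinDynamics (fundamentalLatticeRep 2) β).noise (matrixConfig (fundamentalRep (Fin 2)) (U y u q)) e n i j)) :=
      fun y n u => (hcm n).comp (hadU y u)
    have hAX : ∀ n : NoiseIdx 2, Adapted hWc.natFiltration (fun u (p : {p : ℝ≥0 → (Edge 3 L × NoiseIdx 2 → ℝ) //
        Continuous p ∧ p 0 = 0}) =>
          c ((latticeLangevinDynamics (fundamentalLatticeRep 2) β).noise (matrixConfig (fundamentalRep (Fin 2))
            (if u ≤ s then U x u p else U (U x s p) (u - s)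
              ⟨fun v => p.1 (s + v) - p.1 s, continuous_shiftPath_and_zero hWc s p⟩)) e n i j)) :=
      fun n u => (hcm n).comp (hadX u)
    -- (i) the Riemann–Itô sums of the spliced integrand: differences converge to `c (K (s+r) − K s)`
    have hD : ∀ ε : ℝ, 0 < ε → Tendsto (fun m => (P.map (fun ω => (⟨fun t => W t ω, continuous_path_and_zero hW ω⟩ :
        {p : ℝ≥0 → (Edge 3 L × NoiseIdx 2 → ℝ) // Continuous p ∧ p 0 = 0})))
        {p | ε ≤ |(∑ n : NoiseIdx 2, ((SimpleProcess.sample _ (hAX n) m).integral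
            (fun u (p : {p : ℝ≥0 → (Edge 3 L × NoiseIdx 2 → ℝ) // Continuous p ∧ p 0 = 0}) => p.1 u (e, n)) (s + r) p -
            (SimpleProcess.sample _ (hAX n) m).integral
            (fun u (p : {p : ℝ≥0 → (Edge 3 L × NoiseIdx 2 → ℝ) // Continuous p ∧ p 0 = 0}) => p.1 u (e, n)) s p)) -
          ∑ n : NoiseIdx 2, (c (K n (s + r) p) - c (K n s p))|}) atTop (𝓝 0) := by
      refine tendsto_measure_sum (Finset.univ : Finset (NoiseIdx 2)) fun n _ => ?_
      have hσm : Measurable fun q : {p : ℝ≥0 → (Edge 3 L × NoiseIdx 2 → ℝ) // Continuous p ∧ p 0 = 0} × ℝ =>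
          c ((latticeLangevinDynamics (fundamentalLatticeRep 2) β).noise (matrixConfig (fundamentalRep (Fin 2))
            (if q.2.toNNReal ≤ s then U x q.2.toNNReal q.1 else U (U x s q.1) (q.2.toNNReal - s)
              ⟨fun v => q.1.1 (s + v) - q.1.1 s, continuous_shiftPath_and_zero hWc s q.1⟩)) e n i j) :=
        (hcm n).comp hmX
      have hσc : ∀ᵐ p ∂(P.map (fun ω => (⟨fun t => W t ω, continuous_path_and_zero hW ω⟩ :
          {p : ℝ≥0 → (Edge 3 L × NoiseIdx 2 → ℝ) // Continuous p ∧ p 0 = 0}))), Continuous fun u =>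
          c ((latticeLangevinDynamics (fundamentalLatticeRep 2) β).noise (matrixConfig (fundamentalRep (Fin 2))
            (if u ≤ s then U x u p else U (U x s p) (u - s)
              ⟨fun v => p.1 (s + v) - p.1 s, continuous_shiftPath_and_zero hWc s p⟩)) e n i j) := by
        filter_upwards [hcX] with p hp
        exact (c.continuous.comp (continuous_noise_entry β e n i j)).comp hp
      exact tendsto_measure_sub_of_tendstoUCP (tendstoUCP_integral_sample (hAX n) hσm hσc (hc n (hK n))) (s + r) s
    -- (ii) the frozen solution identity, composed with the restart point and the shifted path
    have hF : ∀ ε : ℝ, 0 < ε → Tendsto (fun m => (P.map (fun ω => (⟨fun t => W t ω, continuous_path_and_zero hW ω⟩ :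
        {p : ℝ≥0 → (Edge 3 L × NoiseIdx 2 → ℝ) // Continuous p ∧ p 0 = 0})))
        {p | ε ≤ |(fun yq : GaugeConfig 3 L (Matrix.specialUnitaryGroup (Fin 2) ℂ) ×
            {p : ℝ≥0 → (Edge 3 L × NoiseIdx 2 → ℝ) // Continuous p ∧ p 0 = 0} =>
          (∑ n : NoiseIdx 2, (SimpleProcess.sample _ (hA yq.1 n) m).integral
            (fun u (p : {p : ℝ≥0 → (Edge 3 L × NoiseIdx 2 → ℝ) // Continuous p ∧ p 0 = 0}) => p.1 u (e, n)) r yq.2) -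
            c ((fundamentalRep (Fin 2) (U yq.1 r yq.2 e) : Matrix (Fin 2) (Fin 2) ℂ) i j -
              (fundamentalRep (Fin 2) (yq.1 e) : Matrix (Fin 2) (Fin 2) ℂ) i j -
              ∫ v in (0 : ℝ)..r, (latticeLangevinDynamics (fundamentalLatticeRep 2) β).drift
                (matrixConfig (fundamentalRep (Fin 2)) (U yq.1 v.toNNReal yq.2)) e i j))
          (U x s p, ⟨fun v => p.1 (s + v) - p.1 s, continuous_shiftPath_and_zero hWc s p⟩)|}) atTop (𝓝 0) := by
      intro ε hε
      exact tendsto_measure_comp_shift_of_forall hW s hYs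
        (fun m => measurable_riemannIdentity_param hW β U hprog e i j c hA m r)
        (fun y => tendsto_measure_riemannIdentity hW β U hU0 hprog hGc hGae hsol e i j c hc hA y r ε hε)
    -- (iii) the two sequences of Riemann sums agree for large `m` (restart identity on the dyadic grid)
    obtain ⟨M₁, hM₁⟩ := exists_nat_ge (s + r)
    have hshift : ∀ m, max m₀ M₁ ≤ m → ∀ p : {p : ℝ≥0 → (Edge 3 L × NoiseIdx 2 → ℝ) // Continuous p ∧ p 0 = 0},
        (∑ n : NoiseIdx 2, ((SimpleProcess.sample _ (hAX n) m).integral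
            (fun u (p : {p : ℝ≥0 → (Edge 3 L × NoiseIdx 2 → ℝ) // Continuous p ∧ p 0 = 0}) => p.1 u (e, n)) (s + r) p -
            (SimpleProcess.sample _ (hAX n) m).integral
            (fun u (p : {p : ℝ≥0 → (Edge 3 L × NoiseIdx 2 → ℝ) // Continuous p ∧ p 0 = 0}) => p.1 u (e, n)) s p)) =
        ∑ n : NoiseIdx 2, (SimpleProcess.sample _ (hA (U x s p) n) m).integral
            (fun u (p : {p : ℝ≥0 → (Edge 3 L × NoiseIdx 2 → ℝ) // Continuous p ∧ p 0 = 0}) => p.1 u (e, n)) r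
            ⟨fun v => p.1 (s + v) - p.1 s, continuous_shiftPath_and_zero hWc s p⟩ := by
      intro m hm p
      refine Finset.sum_congr rfl fun n _ => ?_
      refine sample_integral_shift (hAX n) (hA (U x s p) n) _ _ p _ k₀ m₀ (fun v => ?_) (fun v => rfl)
        (le_trans (le_max_left _ _) hm) (hM₁.trans (by exact_mod_cast le_trans (le_max_right _ _) hm))
      rw [splice_add hW U hU0 x s v p]
    -- (iv) the two limits in probability agree
    have hlim1 : ∀ ε : ℝ, 0 < ε → Tendsto (fun m => (P.map (fun ω => (⟨fun t => W t ω, continuous_path_and_zero hW ω⟩ :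
        {p : ℝ≥0 → (Edge 3 L × NoiseIdx 2 → ℝ) // Continuous p ∧ p 0 = 0})))
        {p | ε ≤ |(∑ n : NoiseIdx 2, ((SimpleProcess.sample _ (hAX n) m).integral
            (fun u (p : {p : ℝ≥0 → (Edge 3 L × NoiseIdx 2 → ℝ) // Continuous p ∧ p 0 = 0}) => p.1 u (e, n)) (s + r) p -
            (SimpleProcess.sample _ (hAX n) m).integral
            (fun u (p : {p : ℝ≥0 → (Edge 3 L × NoiseIdx 2 → ℝ) // Continuous p ∧ p 0 = 0}) => p.1 u (e, n)) s p)) -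
          c (∑ n : NoiseIdx 2, (K n (s + r) p - K n s p))|}) atTop (𝓝 0) := by
      intro ε hε
      refine (hD ε hε).congr' (Eventually.of_forall fun m => ?_)
      congr 1
      ext p
      simp only [Set.mem_setOf_eq, map_sum, map_sub]
    have hlim2 : ∀ ε : ℝ, 0 < ε → Tendsto (fun m => (P.map (fun ω => (⟨fun t => W t ω, continuous_path_and_zero hW ω⟩ :
        {p : ℝ≥0 → (Edge 3 L × NoiseIdx 2 → ℝ) // Continuous p ∧ p 0 = 0})))
        {p | ε ≤ |(∑ n : NoiseIdx 2, ((SimpleProcess.sample _ (hAX n) m).integral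
            (fun u (p : {p : ℝ≥0 → (Edge 3 L × NoiseIdx 2 → ℝ) // Continuous p ∧ p 0 = 0}) => p.1 u (e, n)) (s + r) p -
            (SimpleProcess.sample _ (hAX n) m).integral
            (fun u (p : {p : ℝ≥0 → (Edge 3 L × NoiseIdx 2 → ℝ) // Continuous p ∧ p 0 = 0}) => p.1 u (e, n)) s p)) -
          c ((fundamentalRep (Fin 2) (U (U x s p) r ⟨fun v => p.1 (s + v) - p.1 s,
              continuous_shiftPath_and_zero hWc s p⟩ e) : Matrix (Fin 2) (Fin 2) ℂ) i j -
            (fundamentalRep (Fin 2) (U x s p e) : Matrix (Fin 2) (Fin 2) ℂ) i j -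
            ∫ v in (0 : ℝ)..r, (latticeLangevinDynamics (fundamentalLatticeRep 2) β).drift
              (matrixConfig (fundamentalRep (Fin 2)) (U (U x s p) v.toNNReal
                ⟨fun v => p.1 (s + v) - p.1 s, continuous_shiftPath_and_zero hWc s p⟩)) e i j)|}) atTop (𝓝 0) := by
      intro ε hε
      refine (hF ε hε).congr' ?_
      filter_upwards [eventually_ge_atTop (max m₀ M₁)] with m hm
      congr 1
      ext p
      simp only [Set.mem_setOf_eq, hshift m hm p]
    filter_upwards [ae_eq_of_tendsto_measure hlim2 hlim1] with p hp
    exact hp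
  have hre := key Complex.reCLM (@fun n H Z h => h.1)
  have him := key Complex.imCLM (@fun n H Z h => h.2)
  filter_upwards [hre, him] with p hpre hpim
  exact Complex.ext hpre hpim

end Summit.QuantumFields.YangMills.Theorems.ColdStartUniversality

end
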